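import Summits.QuantumFields.BalabanUV.Beta.D1BFx.PeriodicArraySuperposition

/-!
# `BalabanUV.Beta.D1BFx.PeriodicArrayWrapLimit` — road «BF-x» for binder row D1, slot (K), chain step (I) «(A1)-PACKED», brick «WRAP-LIMIT»
# (`HOME/b2b-balaban-beta-d1-p2/A1-PACKED-SPEC.md` v0.3.1 §8, FINDING F-g16-1 «WRAP», `OWNER-MEMO-g16.md` §3 item 1): **THE `ℤ^D` KERNEL WITH ONE
# WEIGHT PERIODISED TENDS ENTRYWISE TO THE KERNEL WITH BOTH WEIGHTS DECAYING AS THE PERIOD GROWS, WITH AN EXPLICIT WRAP-AROUND TAIL** (the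
# `s`-uniform bi-localisation under bond-separation decay — «WRAP-UNIFORM» — is the companion module `PeriodicArrayWrapUniform`).

HONEST DEPENDENCY (cell records, verbatim): «continuum YM on T⁴ ⇐ BetaPertH ∧ nine spine estimates (0/9 proved); BetaPertH ⇐ (D1) ∧ (D4) ∧
CAP+tail; G-an2-4 gates asym, D1 and NE2/3/4.»  HONEST FRAMING (cell contract, verbatim): «discharging `BetaPertH` makes Bałaban's UV stability
UNCONDITIONAL — a real constructive-QFT result; it is NOT the continuum limit and NOT the Clay problem.»  THIS MODULE DISCHARGES NOTHING of (K),
of D1 or of the wall: [folklore] absolutely convergent `ℤ^D` bookkeeping (termwise exponential majorants, `tsum_of_norm_bounded`, the image tail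
`VolumeImages.imageTail`) over the typed objects `OneStepResolventKernel.wsum`, `VolumeImages.imageShift`, `ExpKernelCalculus.BiLoc`.  No definition,
no `def … : Prop`, nothing cited, 0 sorry.  0 root-level binders of row D1 discharged (hW ∕ hR-sockets ∕ hSX-socket ∕ D1Tel ∕ D1Rep = 0); (K) NOT
closed; NOT D1, NOT `BetaPertH`, NOT continuum, NOT Clay.

ABSOLUTE RULE (cell charter, verbatim): «No internally-minted statement may enter as a cited fact. Every hypothesis is either kernel-proved in this
package or a verbatim quotation of a PUBLISHED theorem with page reference. The manuscript(s) under audit are NOT citable for their own disputed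
steps — they are the thing under adjudication; programme-internal (2001/route/tribunal) claims are never citable.»

WHY (owner d1-p2, FINDING F-g16-1 «WRAP», `A1-PACKED-SPEC.md` §8 (B4d) REPAIR).  Brick (B4d) `PeriodicArrayBiSuperposition.packed₂_eq_arr_periodised` identifies
the torus-packed even second jet with the ARRAY of the `ℤ^D` kernel
`𝒲^{(s)} := wsum w (u ↦ Σ'_{u″} w′_per^{(s)} u″ · K₂ u u″)`, `w′_per^{(s)} u″ := Σ'_m w′ (u″ + s·m)` — ONE weight periodised — and NOT with the road's
`ℤ^D` second table `𝒲 := wsum w (u ↦ Σ'_{u″} w′ u″ · K₂ u u″)`.  The owner's repair passes to `p → ∞` through the explicit-bound TA3b sockets and ONE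
dominated-convergence line on the `ℤ^D` side; that line consumes (i) the ENTRYWISE limit `𝒲^{(s)} x y a b → 𝒲 x y a b` and (ii) a BI-LOCALISATION of
`𝒲^{(s)}` UNIFORM in `s` (the hypothesis shape `∀ k, BiLoc (K k) p q C δ` of `TorusArrayLimitUniform.tendsto_tadpole_of_uniform` ∕ `…_bubble_of_uniform` ∕
`…_hessKer_of_uniform`).  THIS FILE supplies (i) under the (B4d) hypotheses (weights decaying from `p`, `p′`; `BiLoc (K₂ u u′) u u′ Cₖ δ`), with the
explicit wrap-around tail `C·C′·Cₖ·Zl D δ·Zl D (δ∕2)·e^{(δ∕2)|y − p′|₁}·imageTail D (δ s∕2)` («exponentially small in `s` at fixed separation»); the companion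
`PeriodicArrayWrapUniform` supplies (ii) under the BOND-SEPARATION decay of the pair family (the body of `BalabanCompositeJets.LocStencil₂`,
`BiLoc (K₂ u u′) u u (Cₖ·e^{−δ|u′−u|₁}) δ`): `BiLoc 𝒲^{(s)} p p (C·C′·Cₖ·Zl D (δ∕2)³) (δ∕2)` with `s`-free data.  LOCATED REMARK (documentation, not a
theorem): (ii) cannot be had from the (B4d) shape — for `D = 1`, `K₂ u u″ x y = [x = u]·[y = u″]`, `w = [· = p]`, `w′ = [· = p′]` the kernel
`𝒲^{(s)} x y = [x = p]·[y ≡ p′ mod s]` is periodic in `y`, so it is not bi-localised at any pair even for one fixed `s`; the (B4d) shape only gives LEFT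
localisation (`packed₂_eq_arr_periodised`'s internal `hLloc`).

CONTENT (all [folklore]; generic dimension `D`, fibre `F`).
* §1 weights: `const_nonneg_of_weight`, `weight_mono` (a smaller rate), `abs_weight_le_const`, `summable_images_weight`, `abs_tsum_images_le`
  (`|w′_per^{(s)} u| ≤ C′·Zl D δ`), **`abs_tsum_images_sub_le`** (THE PERIODISED WEIGHT'S TAIL `|w′_per^{(s)} u − w′ u| ≤ C′·e^{δ|u − p′|₁}·imageTail D (δ s)`,
  the scalar twin of `PeriodicArrays.abs_arr_sub_le`), `tendsto_tsum_images` (`w′_per^{(s)} u → w′ u`).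
* §2 rows: `summable_weight_row` (a bounded weight against the `u″`-row of `K₂ u`), **`abs_row_images_sub_le`** (the inner `u″`-sum: tail
  `C′·Cₖ·Zl D (δ∕2)·e^{−δ|x−u|₁}·e^{(δ∕2)|y−p′|₁}·imageTail D (δ s∕2)` — §1 at HALF rate, the other half sums the row).
* §3 entries: `summable_outer`, **`abs_wsum_images_sub_le`** (THE WRAP-AROUND TAIL of the entry), **`tendsto_wsum_images`** («WRAP-LIMIT»:
  `𝒲^{(s)} x y a b → 𝒲 x y a b` as `s → ∞`).
Provenance: G-an2-4 swarm leaf seat `b2b-balaban-gan24-formalise-leaf-05` (gen 50), cross-lane brick «WRAP-LIMIT» for road «BF-x», 2026-08-22.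
-/

noncomputable section

namespace Summit.QuantumFields.BalabanUV.Beta.D1BFx.PeriodicArrayWrapLimit

open Filter Topology
open scoped BigOperators
open Literature.MathematicalPhysics.QuantumFieldTheory.Balaban1983to89
open Literature.MathematicalPhysics.QuantumFieldTheory.Balaban1983to89.Beta
open B12Sec2to5 (l1 l1_nonneg summable_exp_neg_l1)
open ExpKernelCalculus (MKer BiLoc Zl Zl_pos Zl_nonneg summable_exp_shift summable_exp_shift' tsum_exp_shift tsum_exp_shift'
  l1_sub_triangle l1_sub_symm)
open OneStepResolventKernel (wsum)
open Summit.QuantumFields.BalabanUV.Beta.D1BFx.PeriodicArrays (tsum_exp_imageShift_le exp_imageShift_sub_le)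

variable {D : ℕ} {F : Type*}

/-! ## §1 Decaying weights and the periodised weight's tail -/

section Weight

variable {w' : ExpKernelCalculus.Site D → ℝ} {C' δ : ℝ} {p' : ExpKernelCalculus.Site D}

/-- [folklore] The constant of a decaying-weight bound is nonnegative (test the bound at the centre). -/
theorem const_nonneg_of_weight (hw' : ∀ u, |w' u| ≤ C' * Real.exp (-δ * l1 (u - p'))) : 0 ≤ C' := by
  have h := hw' p'
  have h1 : Real.exp (-δ * l1 (p' - p')) = 1 := by simp [l1]
  rw [h1, mul_one] at h
  exact (abs_nonneg _).trans h

/-- [folklore] A weight decaying at rate `δ` decays at every rate `δ′ ≤ δ` with the same constant. -/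
theorem weight_mono (hw' : ∀ u, |w' u| ≤ C' * Real.exp (-δ * l1 (u - p'))) {δ' : ℝ} (hle : δ' ≤ δ)
    (u : ExpKernelCalculus.Site D) : |w' u| ≤ C' * Real.exp (-δ' * l1 (u - p')) := by
  refine (hw' u).trans (mul_le_mul_of_nonneg_left (Real.exp_le_exp.2 ?_) (const_nonneg_of_weight hw'))
  nlinarith [l1_nonneg (u - p')]

/-- [folklore] A weight decaying at a rate `δ ≥ 0` is bounded by its constant. -/
theorem abs_weight_le_const (hw' : ∀ u, |w' u| ≤ C' * Real.exp (-δ * l1 (u - p'))) (hδ : 0 ≤ δ) (u : ExpKernelCalculus.Site D) :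
    |w' u| ≤ C' := by
  have h := weight_mono hw' hδ u
  rwa [neg_zero, zero_mul, Real.exp_zero, mul_one] at h

/-- [folklore] The image series `m ↦ w′ (u + s·m)` of a decaying weight converges (`δ > 0`, `s ≥ 1`). -/
theorem summable_images_weight (hw' : ∀ u, |w' u| ≤ C' * Real.exp (-δ * l1 (u - p'))) (hδ : 0 < δ) (s : ℕ) [NeZero s]
    (u : ExpKernelCalculus.Site D) : Summable fun m : ExpKernelCalculus.Site D => w' (imageShift s u m) :=
  Summable.of_norm_bounded (((tsum_exp_imageShift_le hδ s u p').1).mul_left C') fun m => by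
    rw [Real.norm_eq_abs]; exact hw' _

/-- [folklore] THE PERIODISED WEIGHT IS BOUNDED: `|Σ'_m w′ (u + s·m)| ≤ C′·Zl D δ` (`δ > 0`, `s ≥ 1`). -/
theorem abs_tsum_images_le (hw' : ∀ u, |w' u| ≤ C' * Real.exp (-δ * l1 (u - p'))) (hδ : 0 < δ) (s : ℕ) [NeZero s]
    (u : ExpKernelCalculus.Site D) : |∑' m : ExpKernelCalculus.Site D, w' (imageShift s u m)| ≤ C' * Zl D δ := by
  have hmaj := ((tsum_exp_imageShift_le hδ s u p').1).mul_left C'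
  have h := tsum_of_norm_bounded hmaj.hasSum (fun m => by rw [Real.norm_eq_abs]; exact hw' (imageShift s u m))
  rw [Real.norm_eq_abs] at h
  refine h.trans ?_
  rw [tsum_mul_left]
  exact mul_le_mul_of_nonneg_left (tsum_exp_imageShift_le hδ s u p').2 (const_nonneg_of_weight hw')

/-- [folklore] **THE PERIODISED WEIGHT'S TAIL**: `|Σ'_m w′ (u + s·m) − w′ u| ≤ C′·e^{δ|u − p′|₁}·imageTail D (δ·s)` — every image but `m = 0` sits at
`ℓ¹`-distance `≥ s|m|₁ − |u − p′|₁` from the centre (the scalar twin of `PeriodicArrays.abs_arr_sub_le`). -/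
theorem abs_tsum_images_sub_le (hw' : ∀ u, |w' u| ≤ C' * Real.exp (-δ * l1 (u - p'))) (hδ : 0 < δ) (s : ℕ) [NeZero s]
    (u : ExpKernelCalculus.Site D) :
    |∑' m : ExpKernelCalculus.Site D, w' (imageShift s u m) - w' u| ≤ C' * Real.exp (δ * l1 (u - p')) * imageTail D (δ * s) := by
  have hC' : 0 ≤ C' := const_nonneg_of_weight hw'
  set f : ExpKernelCalculus.Site D → ℝ := fun m => w' (imageShift s u m) with hf
  have h0 : f 0 = w' u := by simp [hf]
  have hsplit : ∑' m, f m - w' u = ∑' m : ExpKernelCalculus.Site D, if m = 0 then 0 else f m := by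
    rw [← h0, (summable_images_weight hw' hδ s u).tsum_eq_add_tsum_ite 0]; ring
  rw [hsplit]
  have hmaj : ∀ m : ExpKernelCalculus.Site D, ‖(if m = 0 then 0 else f m)‖ ≤
      C' * Real.exp (δ * l1 (u - p')) * (if m = 0 then 0 else Real.exp (-(δ * s) * l1 m)) := fun m => by
    rw [Real.norm_eq_abs]
    split_ifs with hm
    · simp
    · calc |f m| ≤ C' * Real.exp (-δ * l1 (imageShift s u m - p')) := hw' _
        _ ≤ C' * (Real.exp (δ * l1 (u - p')) * Real.exp (-(δ * s) * l1 m)) :=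
            mul_le_mul_of_nonneg_left (exp_imageShift_sub_le hδ.le s u m p') hC'
        _ = _ := by ring
  have hst : Summable fun m : ExpKernelCalculus.Site D =>
      C' * Real.exp (δ * l1 (u - p')) * (if m = 0 then 0 else Real.exp (-(δ * s) * l1 m)) :=
    (summable_imageTail_term (mul_pos hδ (by exact_mod_cast Nat.pos_of_ne_zero (NeZero.ne s)))).mul_left _
  simpa only [Real.norm_eq_abs, tsum_mul_left, imageTail] using tsum_of_norm_bounded hst.hasSum hmaj

/-- [folklore] **THE PERIODISED WEIGHT'S LIMIT**: `Σ'_m w′ (u + s·m) → w′ u` as `s → ∞` (`VolumeImages.tendsto_imageTail_atTop`). -/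
theorem tendsto_tsum_images (hw' : ∀ u, |w' u| ≤ C' * Real.exp (-δ * l1 (u - p'))) (hδ : 0 < δ) (u : ExpKernelCalculus.Site D) :
    Tendsto (fun s : ℕ => ∑' m : ExpKernelCalculus.Site D, w' (imageShift s u m)) atTop (𝓝 (w' u)) := by
  have hmaj : Tendsto (fun s : ℕ => C' * Real.exp (δ * l1 (u - p')) * imageTail D (δ * s)) atTop (𝓝 0) := by
    have h1 : Tendsto (fun s : ℕ => δ * (s : ℝ)) atTop atTop := Tendsto.const_mul_atTop hδ tendsto_natCast_atTop_atTop
    simpa using ((tendsto_imageTail_atTop D).comp h1).const_mul (C' * Real.exp (δ * l1 (u - p')))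
  have hev : ∀ᶠ s : ℕ in atTop, ‖∑' m : ExpKernelCalculus.Site D, w' (imageShift s u m) - w' u‖
      ≤ C' * Real.exp (δ * l1 (u - p')) * imageTail D (δ * s) := by
    filter_upwards [eventually_ge_atTop 1] with s hs
    haveI : NeZero s := ⟨by omega⟩
    simpa only [Real.norm_eq_abs] using abs_tsum_images_sub_le hw' hδ s u
  exact tendsto_sub_nhds_zero_iff.mp (squeeze_zero_norm' hev hmaj)

end Weight

/-! ## §2 The `u″`-row of the pair family against a weight -/

section Row

variable {w' : ExpKernelCalculus.Site D → ℝ} {K₂ : ExpKernelCalculus.Site D → ExpKernelCalculus.Site D → MKer D F} {C' Ck δ : ℝ}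
  {p' : ExpKernelCalculus.Site D}

/-- [folklore] A BOUNDED weight against the `u″`-row of a pair family bi-localised at `(u, u″)`: the row series converges and
`|Σ'_{u″} ω u″ · K₂ u u″ x y a b| ≤ B·Cₖ·Zl D δ·e^{−δ|x − u|₁}` (the `y`-side localisation sums the row). -/
theorem summable_weight_row {ω : ExpKernelCalculus.Site D → ℝ} {B : ℝ} (hω : ∀ u'', |ω u''| ≤ B)
    (hK : ∀ u u', BiLoc (K₂ u u') u u' Ck δ) (hδ : 0 < δ) (hB : 0 ≤ B) (u x y : ExpKernelCalculus.Site D) (a b : F) :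
    (Summable fun u'' => ω u'' * K₂ u u'' x y a b) ∧
      |∑' u'', ω u'' * K₂ u u'' x y a b| ≤ B * Ck * Zl D δ * Real.exp (-δ * l1 (x - u)) := by
  have hmaj := (summable_exp_shift hδ y).mul_left (B * Ck * Real.exp (-δ * l1 (x - u)))
  have hb : ∀ u'', ‖ω u'' * K₂ u u'' x y a b‖ ≤ B * Ck * Real.exp (-δ * l1 (x - u)) * Real.exp (-δ * l1 (y - u'')) := by
    intro u''
    rw [Real.norm_eq_abs, abs_mul]
    calc |ω u''| * |K₂ u u'' x y a b| ≤ B * (Ck * Real.exp (-δ * (l1 (x - u) + l1 (y - u'')))) :=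
          mul_le_mul (hω u'') (hK u u'' x y a b) (abs_nonneg _) hB
      _ = _ := by rw [mul_add, Real.exp_add]; ring
  refine ⟨Summable.of_norm_bounded hmaj hb, ?_⟩
  have h := tsum_of_norm_bounded hmaj.hasSum hb
  rw [Real.norm_eq_abs] at h
  refine h.trans (le_of_eq ?_)
  rw [tsum_mul_left, tsum_exp_shift]; ring

/-- [folklore] **THE ROW'S WRAP-AROUND TAIL**: for a weight `w′` decaying from `p′` and a pair family bi-localised at `(u, u″)`,
`|Σ'_{u″} (Σ'_m w′ (u″ + s·m)) · K₂ u u″ x y a b − Σ'_{u″} w′ u″ · K₂ u u″ x y a b| ≤ C′·Cₖ·Zl D (δ∕2)·e^{−δ|x−u|₁}·e^{(δ∕2)|y−p′|₁}·imageTail D (δ s∕2)`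
(§1's tail at HALF the rate: its growth `e^{(δ∕2)|u″−p′|₁} ≤ e^{(δ∕2)|y−p′|₁}·e^{(δ∕2)|y−u″|₁}` is absorbed by half of the row's `y`-side decay, the other half sums the row). -/
theorem abs_row_images_sub_le (hw' : ∀ u, |w' u| ≤ C' * Real.exp (-δ * l1 (u - p'))) (hK : ∀ u u', BiLoc (K₂ u u') u u' Ck δ)
    (hδ : 0 < δ) (s : ℕ) [NeZero s] (u x y : ExpKernelCalculus.Site D) (a b : F) :
    |∑' u'', (∑' m : ExpKernelCalculus.Site D, w' (imageShift s u'' m)) * K₂ u u'' x y a b - ∑' u'', w' u'' * K₂ u u'' x y a b|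
      ≤ C' * Ck * Zl D (δ / 2) * Real.exp (-δ * l1 (x - u)) * Real.exp (δ / 2 * l1 (y - p')) * imageTail D (δ / 2 * s) := by
  have hC' : 0 ≤ C' := const_nonneg_of_weight hw'
  have hCk : 0 ≤ Ck := (hK u u).nonneg a
  have hδ2 : 0 < δ / 2 := half_pos hδ
  have hI : 0 ≤ imageTail D (δ / 2 * s) := imageTail_nonneg D _
  -- both rows converge
  have hS1 := (summable_weight_row (fun u'' => abs_tsum_images_le hw' hδ s u'') hK hδ (mul_nonneg hC' (Zl_nonneg hδ)) u x y a b).1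
  have hS2 := (summable_weight_row (fun u'' => abs_weight_le_const hw' hδ.le u'') hK hδ hC' u x y a b).1
  rw [← hS1.tsum_sub hS2]
  -- termwise majorant: §1 at rate `δ∕2`
  have hw2 : ∀ v, |w' v| ≤ C' * Real.exp (-(δ / 2) * l1 (v - p')) := weight_mono hw' (half_le_self hδ.le)
  set M : ℝ := C' * Ck * Zl D (δ / 2) * Real.exp (-δ * l1 (x - u)) * Real.exp (δ / 2 * l1 (y - p')) * imageTail D (δ / 2 * s) with hM
  set M₀ : ℝ := C' * Ck * Real.exp (-δ * l1 (x - u)) * Real.exp (δ / 2 * l1 (y - p')) * imageTail D (δ / 2 * s) with hM₀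
  have hmaj := (summable_exp_shift hδ2 y).mul_left M₀
  have hb : ∀ u'', ‖(∑' m : ExpKernelCalculus.Site D, w' (imageShift s u'' m)) * K₂ u u'' x y a b - w' u'' * K₂ u u'' x y a b‖
      ≤ M₀ * Real.exp (-(δ / 2) * l1 (y - u'')) := by
    intro u''
    rw [Real.norm_eq_abs, ← sub_mul, abs_mul]
    have h1 := abs_tsum_images_sub_le hw2 hδ2 s u''
    have h2 := hK u u'' x y a b
    have htri : l1 (u'' - p') ≤ l1 (y - u'') + l1 (y - p') := by
      have h := l1_sub_triangle u'' y p'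
      rw [l1_sub_symm u'' y] at h
      exact h
    have htri' := mul_le_mul_of_nonneg_left htri hδ2.le
    have key : Real.exp (δ / 2 * l1 (u'' - p')) * Real.exp (-δ * (l1 (x - u) + l1 (y - u'')))
        ≤ Real.exp (-δ * l1 (x - u)) * Real.exp (δ / 2 * l1 (y - p')) * Real.exp (-(δ / 2) * l1 (y - u'')) := by
      rw [← Real.exp_add, ← Real.exp_add, ← Real.exp_add, Real.exp_le_exp]
      nlinarith [l1_nonneg (y - u''), hδ.le]
    have h1pos : 0 ≤ C' * Real.exp (δ / 2 * l1 (u'' - p')) * imageTail D (δ / 2 * s) := by positivity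
    calc |∑' m : ExpKernelCalculus.Site D, w' (imageShift s u'' m) - w' u''| * |K₂ u u'' x y a b|
        ≤ (C' * Real.exp (δ / 2 * l1 (u'' - p')) * imageTail D (δ / 2 * s)) * (Ck * Real.exp (-δ * (l1 (x - u) + l1 (y - u'')))) :=
          mul_le_mul h1 h2 (abs_nonneg _) h1pos
      _ = C' * Ck * imageTail D (δ / 2 * s) * (Real.exp (δ / 2 * l1 (u'' - p')) * Real.exp (-δ * (l1 (x - u) + l1 (y - u'')))) := by
          ring
      _ ≤ C' * Ck * imageTail D (δ / 2 * s)
            * (Real.exp (-δ * l1 (x - u)) * Real.exp (δ / 2 * l1 (y - p')) * Real.exp (-(δ / 2) * l1 (y - u''))) :=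
          mul_le_mul_of_nonneg_left key (by positivity)
      _ = M₀ * Real.exp (-(δ / 2) * l1 (y - u'')) := by rw [hM₀]; ring
  have h := tsum_of_norm_bounded hmaj.hasSum hb
  rw [Real.norm_eq_abs] at h
  refine h.trans (le_of_eq ?_)
  rw [tsum_mul_left, tsum_exp_shift, hM, hM₀]; ring

end Row

/-! ## §3 The entry of the superposition: the wrap-around tail and the limit «WRAP-LIMIT» -/

section Entry

variable {w w' : ExpKernelCalculus.Site D → ℝ} {K₂ : ExpKernelCalculus.Site D → ExpKernelCalculus.Site D → MKer D F} {C C' Ck δ : ℝ}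
  {p p' : ExpKernelCalculus.Site D}

/-- [folklore] A decaying weight against a BOUNDED family of scalars: `u ↦ w u · I u` is summable and `|Σ'_u w u · I u| ≤ C·B·Zl D δ`. -/
theorem summable_outer {I : ExpKernelCalculus.Site D → ℝ} {B : ℝ} (hw : ∀ u, |w u| ≤ C * Real.exp (-δ * l1 (u - p)))
    (hI : ∀ u, |I u| ≤ B) (hδ : 0 < δ) :
    (Summable fun u => w u * I u) ∧ |∑' u, w u * I u| ≤ C * B * Zl D δ := by
  have hmaj := (summable_exp_shift' hδ p).mul_left (C * B)
  have hb : ∀ u, ‖w u * I u‖ ≤ C * B * Real.exp (-δ * l1 (u - p)) := fun u => by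
    rw [Real.norm_eq_abs, abs_mul]
    calc |w u| * |I u| ≤ (C * Real.exp (-δ * l1 (u - p))) * B := mul_le_mul (hw u) (hI u) (abs_nonneg _) ((abs_nonneg _).trans (hw u))
      _ = _ := by ring
  refine ⟨Summable.of_norm_bounded hmaj hb, ?_⟩
  have h := tsum_of_norm_bounded hmaj.hasSum hb
  rw [Real.norm_eq_abs] at h
  refine h.trans (le_of_eq ?_)
  rw [tsum_mul_left, tsum_exp_shift']

/-- [folklore] **THE WRAP-AROUND TAIL OF THE ENTRY**: for weights `w`, `w′` decaying from `p`, `p′` (rate `δ > 0`), a pair family `K₂ u u″` bi-localised at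
`(u, u″)`, and any period `s ≥ 1`,
`|𝒲^{(s)} x y a b − 𝒲 x y a b| ≤ C·C′·Cₖ·Zl D δ·Zl D (δ∕2)·e^{(δ∕2)|y − p′|₁}·imageTail D (δ s∕2)`,
`𝒲^{(s)} := wsum w (u ↦ Σ'_{u″} (Σ'_m w′ (u″ + s·m)) · K₂ u u″)` (ONE weight periodised — the (B4d) right-hand kernel), `𝒲 := wsum w (u ↦ Σ'_{u″} w′ u″ · K₂ u u″)`
(both weights decaying — the road's `ℤ^D` second table): «exponentially small in `s` at fixed separation». -/
theorem abs_wsum_images_sub_le (hw : ∀ u, |w u| ≤ C * Real.exp (-δ * l1 (u - p))) (hw' : ∀ u, |w' u| ≤ C' * Real.exp (-δ * l1 (u - p')))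
    (hK : ∀ u u', BiLoc (K₂ u u') u u' Ck δ) (hδ : 0 < δ) (s : ℕ) [NeZero s] (x y : ExpKernelCalculus.Site D) (a b : F) :
    |wsum w (fun u => fun x y a b => ∑' u'', (∑' m : ExpKernelCalculus.Site D, w' (imageShift s u'' m)) * K₂ u u'' x y a b) x y a b
        - wsum w (fun u => fun x y a b => ∑' u'', w' u'' * K₂ u u'' x y a b) x y a b|
      ≤ C * C' * Ck * Zl D δ * Zl D (δ / 2) * Real.exp (δ / 2 * l1 (y - p')) * imageTail D (δ / 2 * s) := by
  have hC : 0 ≤ C := const_nonneg_of_weight hw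
  have hC' : 0 ≤ C' := const_nonneg_of_weight hw'
  have hCk : 0 ≤ Ck := (hK p p).nonneg a
  have hI : 0 ≤ imageTail D (δ / 2 * s) := imageTail_nonneg D _
  simp only [wsum]
  -- the two outer series converge (rows bounded uniformly in `u`: drop the `x`-side factor `e^{−δ|x−u|₁} ≤ 1`)
  have hdrop : ∀ u : ExpKernelCalculus.Site D, Real.exp (-δ * l1 (x - u)) ≤ 1 := fun u =>
    Real.exp_le_one_iff.2 (by nlinarith [l1_nonneg (x - u), hδ.le])
  have hR1 : ∀ u, |∑' u'', (∑' m : ExpKernelCalculus.Site D, w' (imageShift s u'' m)) * K₂ u u'' x y a b| ≤ C' * Zl D δ * Ck * Zl D δ := by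
    intro u
    have h := (summable_weight_row (fun u'' => abs_tsum_images_le hw' hδ s u'') hK hδ (mul_nonneg hC' (Zl_nonneg hδ)) u x y a b).2
    refine h.trans ?_
    have hpos : 0 ≤ C' * Zl D δ * Ck * Zl D δ := by
      have := Zl_nonneg (D := D) hδ; positivity
    simpa using mul_le_mul_of_nonneg_left (hdrop u) hpos
  have hR2 : ∀ u, |∑' u'', w' u'' * K₂ u u'' x y a b| ≤ C' * Ck * Zl D δ := by
    intro u
    have h := (summable_weight_row (fun u'' => abs_weight_le_const hw' hδ.le u'') hK hδ hC' u x y a b).2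
    refine h.trans ?_
    have hpos : 0 ≤ C' * Ck * Zl D δ := by
      have := Zl_nonneg (D := D) hδ; positivity
    simpa using mul_le_mul_of_nonneg_left (hdrop u) hpos
  have hS1 := (summable_outer hw hR1 hδ).1
  have hS2 := (summable_outer hw hR2 hδ).1
  rw [← hS1.tsum_sub hS2]
  -- termwise majorant from §2
  set M : ℝ := C' * Ck * Zl D (δ / 2) * Real.exp (δ / 2 * l1 (y - p')) * imageTail D (δ / 2 * s) with hM
  have hMpos : 0 ≤ M := by
    have := Zl_nonneg (D := D) (half_pos hδ); positivity
  have hmaj := (summable_exp_shift' hδ p).mul_left (C * M)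
  have hb : ∀ u, ‖w u * ∑' u'', (∑' m : ExpKernelCalculus.Site D, w' (imageShift s u'' m)) * K₂ u u'' x y a b
        - w u * ∑' u'', w' u'' * K₂ u u'' x y a b‖ ≤ C * M * Real.exp (-δ * l1 (u - p)) := by
    intro u
    rw [Real.norm_eq_abs, ← mul_sub, abs_mul]
    have h1 := abs_row_images_sub_le hw' hK hδ s u x y a b
    have h1' : |∑' u'', (∑' m : ExpKernelCalculus.Site D, w' (imageShift s u'' m)) * K₂ u u'' x y a b
        - ∑' u'', w' u'' * K₂ u u'' x y a b| ≤ M := by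
      refine h1.trans ?_
      have e : M = C' * Ck * Zl D (δ / 2) * 1 * Real.exp (δ / 2 * l1 (y - p')) * imageTail D (δ / 2 * s) := by rw [hM]; ring
      rw [e]
      have := Zl_nonneg (D := D) (half_pos hδ)
      exact mul_le_mul_of_nonneg_right (mul_le_mul_of_nonneg_right (mul_le_mul_of_nonneg_left (hdrop u) (by positivity))
        (by positivity)) hI
    calc |w u| * |∑' u'', (∑' m : ExpKernelCalculus.Site D, w' (imageShift s u'' m)) * K₂ u u'' x y a b
          - ∑' u'', w' u'' * K₂ u u'' x y a b| ≤ (C * Real.exp (-δ * l1 (u - p))) * M :=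
          mul_le_mul (hw u) h1' (abs_nonneg _) ((abs_nonneg _).trans (hw u))
      _ = _ := by ring
  have h := tsum_of_norm_bounded hmaj.hasSum hb
  rw [Real.norm_eq_abs] at h
  refine h.trans (le_of_eq ?_)
  rw [tsum_mul_left, tsum_exp_shift', hM]; ring

/-- [folklore] **«WRAP-LIMIT» — THE KERNEL WITH ONE WEIGHT PERIODISED TENDS ENTRYWISE TO THE KERNEL WITH BOTH WEIGHTS DECAYING**: under the hypotheses
of `abs_wsum_images_sub_le`, for every entry `(x, y, a, b)`,
`wsum w (u ↦ Σ'_{u″} (Σ'_m w′ (u″ + s·m)) · K₂ u u″) x y a b → wsum w (u ↦ Σ'_{u″} w′ u″ · K₂ u u″) x y a b` as `s → ∞`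
(the owner's «ONE dominated-convergence line on the `ℤ^D` side», F-g16-1: `𝒲M^{(p)} → 𝒲M` entrywise). -/
theorem tendsto_wsum_images (hw : ∀ u, |w u| ≤ C * Real.exp (-δ * l1 (u - p))) (hw' : ∀ u, |w' u| ≤ C' * Real.exp (-δ * l1 (u - p')))
    (hK : ∀ u u', BiLoc (K₂ u u') u u' Ck δ) (hδ : 0 < δ) (x y : ExpKernelCalculus.Site D) (a b : F) :
    Tendsto (fun s : ℕ =>
        wsum w (fun u => fun x y a b => ∑' u'', (∑' m : ExpKernelCalculus.Site D, w' (imageShift s u'' m)) * K₂ u u'' x y a b) x y a b)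
      atTop (𝓝 (wsum w (fun u => fun x y a b => ∑' u'', w' u'' * K₂ u u'' x y a b) x y a b)) := by
  set M : ℝ := C * C' * Ck * Zl D δ * Zl D (δ / 2) * Real.exp (δ / 2 * l1 (y - p')) with hM
  have hmaj : Tendsto (fun s : ℕ => M * imageTail D (δ / 2 * s)) atTop (𝓝 0) := by
    have h1 : Tendsto (fun s : ℕ => δ / 2 * (s : ℝ)) atTop atTop := Tendsto.const_mul_atTop (half_pos hδ) tendsto_natCast_atTop_atTop
    simpa using ((tendsto_imageTail_atTop D).comp h1).const_mul M
  have hev : ∀ᶠ s : ℕ in atTop,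
      ‖wsum w (fun u => fun x y a b => ∑' u'', (∑' m : ExpKernelCalculus.Site D, w' (imageShift s u'' m)) * K₂ u u'' x y a b) x y a b
        - wsum w (fun u => fun x y a b => ∑' u'', w' u'' * K₂ u u'' x y a b) x y a b‖ ≤ M * imageTail D (δ / 2 * s) := by
    filter_upwards [eventually_ge_atTop 1] with s hs
    haveI : NeZero s := ⟨by omega⟩
    simpa only [Real.norm_eq_abs, hM] using abs_wsum_images_sub_le hw hw' hK hδ s x y a b
  exact tendsto_sub_nhds_zero_iff.mp (squeeze_zero_norm' hev hmaj)

end Entry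

end Summit.QuantumFields.BalabanUV.Beta.D1BFx.PeriodicArrayWrapLimit

end
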